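import Summits.AtomisticToContinuum.Crystallization.Theorems.FrustratedLawDichotomyPairPotentialDoorX
import Summits.AtomisticToContinuum.Crystallization.Theorems.FrustratedLawDichotomyExemptLocalSharp
import Summits.AtomisticToContinuum.Crystallization.Theorems.FrustratedLawDichotomyExemptMoveDipole

/-!
# FrustratedLawDichotomy · crux `AperiodicFrustratedLawGap` (stmt-AtomisticToContinuum-27623) — MOTIF-LEVEL EXEMPTIONS THAT TRANSFER:
# the local exchange test and the one-atom move with dipole slack, through the X-door (decomp-a2c, prover hand 2, structural share, generation 15)

Instances of `…PairPotentialDoorX.MotifTransfer ϱ ExM Ex` for the optimality line, and the crux BY NAME from an X-motif certificate whose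
exemption column is DECIDED ON THE MOTIF:

* §1 `exchangeUnstableLoc_of_motif` / `motifTransfer_exchangeUnstableLoc` — `ExchangeUnstableLoc ε ϱ′ Rm K` evaluated on the radius-`ϱ` motif of a
  site (`Rm, ϱ′ ≤ ϱ`) implies itself on the cluster (the motif contains the `Rm`-ball; a competitor avoiding the motif avoids the cluster); hence
  `motifTransfer_exchangeUnstable_sharp : ϱ′ + D ≤ Rm ≤ ϱ → 1 ≤ D → MotifTransfer ϱ (ExchangeUnstableLoc (ε + 2K·T♯(D)) ϱ′ Rm K) (ExchangeUnstable ε ϱ′ K)`;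
* §2 `MoveUnstableLoc ε Rm s` — the ONE-ATOM MOVE test of `…ExemptMoveDipole` as a site predicate (`Sep y ∧ ∃ p`, `dist p (y j) ≤ s`, `< 7/10`, local gain
  over the atoms within `Rm` of `y_j` `> ε + s·(Rm/(Rm−s))⁷·S₇♯(Rm)`); `exchangeUnstable_of_moveUnstableLoc` (`1 + s ≤ Rm` ⟹ `ExchangeUnstable ε s 1`),
  `moveUnstableLoc_of_motif`, ★ `motifTransfer_exchangeUnstable_of_move : 1 + s ≤ Rm → Rm ≤ ϱ → MotifTransfer ϱ (MoveUnstableLoc ε Rm s) (ExchangeUnstable ε s 1)`,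
  `deepAbsent_moveUnstableLoc`;
* §3 ★★ `aperiodicFrustratedLawGap_of_schurMotifX_move_fourHalf` : `MuEquilibriumDoor ∧ SF₄₅ ∧ UP(−0.7175) ∧ [rule F: range R′, locality ρ, bound B] ∧
  X-motif certificate at W₄₅ with level (e₁, −C, 0, −C), e₁ > −0.7175, capped scale D, radius ϱ ≥ max (9/2, R′ + ρ, ρ, R′, 13/10·D + 1, Rm), 1 + s ≤ Rm,
  ε > 0, exemption column `MoveUnstableLoc ε Rm s` ⟹` crux; and the `ExchangeUnstableLoc` twin `…_exchangeLoc_fourHalf` (sharp slack `2K·T♯(D)`).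

READING (census TAG 181 (c) / lens-5 g38): the rule search may now give the credit `C` to every motif whose CENTRE is capped-`1/20`-good OR admits a
one-atom move of step `≤ s` with local gain `> ε + slack` (slack `≤ 3/5000` at `(Rm, s) = (7, 1/20)`, `…ExemptMoveDipole.dipoleSlack_seven_twentieth_le`);
only ε-Nash motifs need pricing.  All `[folklore]` bookkeeping; 0 sorry.
-/

noncomputable section

namespace Summit.AtomisticToContinuum.Crystallization.Theorems.FrustratedLawDichotomyPairPotentialDoorXMoves

open scoped BigOperators Classical
open Metric
open Literature.MathematicalPhysics.StatisticalMechanics (interactionEnergy lennardJones)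
open Summit.AtomisticToContinuum.Crystallization.Theorems.ChargedEnergyGapNegative (E3 eStar)
open Summit.AtomisticToContinuum.Crystallization.Theorems.FrustratedLawDichotomyRangeCut
open Summit.AtomisticToContinuum.Crystallization.Theorems.FrustratedLawDichotomyLocalDischargingRule
open Summit.AtomisticToContinuum.Crystallization.Theorems.FrustratedLawDichotomySchurCut
open Summit.AtomisticToContinuum.Crystallization.Theorems.FrustratedLawDichotomyPairPotentialDoorX
open Summit.AtomisticToContinuum.Crystallization.Theorems.FrustratedLawDichotomyExemptDoor (SitePred DeepAbsent)
open Summit.AtomisticToContinuum.Crystallization.Theorems.FrustratedLawDichotomyExemptRemoval (tailConst SchurRangeGapX)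
open Summit.AtomisticToContinuum.Crystallization.Theorems.FrustratedLawDichotomyExemptLocOpt
  (ExchangeUnstable locOptDepth deepAbsent_exchangeUnstable)
open Summit.AtomisticToContinuum.Crystallization.Theorems.FrustratedLawDichotomyExemptLocal (ExchangeUnstableLoc exchangeUnstable_of_loc)
open Summit.AtomisticToContinuum.Crystallization.Theorems.FrustratedLawDichotomyExemptLocalSharp (tailConstSharp exchangeUnstable_of_loc_sharp)
open Summit.AtomisticToContinuum.Crystallization.Theorems.FrustratedLawDichotomyExemptMoveDipole (exchangeUnstable_one_of_localMove_dipole)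

/-! ## §1. The local exchange test transfers from the motif to the cluster -/

/-- The `Rm`-ball of the centre is the same in the motif and in the cluster (`Rm ≤ ϱ`). [folklore] -/
theorem range_inter_ball_motif {Rm ϱ : ℝ} (hRm : Rm ≤ ϱ) {N M : ℕ} {y : Fin N → E3} {φ : Fin M → Fin N} {c : Fin M}
    (hS : ∀ k : Fin N, dist (y k) (y (φ c)) ≤ ϱ → k ∈ Set.range φ) :
    Set.range (y ∘ φ) ∩ closedBall ((y ∘ φ) c) Rm = Set.range y ∩ closedBall (y (φ c)) Rm := by
  ext q
  constructor
  · rintro ⟨⟨a, rfl⟩, hq⟩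
    exact ⟨⟨φ a, rfl⟩, hq⟩
  · rintro ⟨⟨k, rfl⟩, hq⟩
    obtain ⟨a, rfl⟩ := hS k ((mem_closedBall.1 hq).trans hRm)
    exact ⟨⟨a, rfl⟩, hq⟩

/-- **`ExchangeUnstableLoc` on the motif ⟹ on the cluster** (`Rm, ϱ′ ≤ ϱ`; the motif contains every cluster atom within `ϱ` of the centre). [folklore] -/
theorem exchangeUnstableLoc_of_motif {ε ϱ' Rm ϱ : ℝ} {K : ℕ} (hRm : Rm ≤ ϱ) (hϱ' : ϱ' ≤ ϱ)
    {N M : ℕ} {y : Fin N → E3} {φ : Fin M → Fin N} {c : Fin M} (hsep : Sep y)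
    (hS : ∀ k : Fin N, dist (y k) (y (φ c)) ≤ ϱ → k ∈ Set.range φ)
    (h : ExchangeUnstableLoc ε ϱ' Rm K M (y ∘ φ) c) : ExchangeUnstableLoc ε ϱ' Rm K N y (φ c) := by
  obtain ⟨-, a, s, R, haK, hs, hsZ, hsball, hR, hRball, hdisj, hlt⟩ := h
  have hsub : Set.range (y ∘ φ) ⊆ Set.range y := Set.range_comp_subset_range φ y
  refine ⟨hsep, a, s, R, haK, hs, hsZ.trans hsub, hsball, hR, hRball, ?_, ?_⟩
  · rw [Set.disjoint_left]
    rintro _ ⟨l, rfl⟩ ⟨⟨k, hk⟩, hns⟩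
    have hkφ : k ∈ Set.range φ := hS k (by rw [hk]; exact (hRball l).trans hϱ')
    obtain ⟨b, rfl⟩ := hkφ
    exact (Set.disjoint_left.1 hdisj) ⟨l, rfl⟩ ⟨⟨b, hk⟩, hns⟩
  · rw [range_inter_ball_motif hRm hS] at hlt
    exact hlt

/-- **`MotifTransfer` for the local exchange test onto itself.** [folklore] -/
theorem motifTransfer_exchangeUnstableLoc {ε ϱ' Rm ϱ : ℝ} {K : ℕ} (hRm : Rm ≤ ϱ) (hϱ' : ϱ' ≤ ϱ) :
    MotifTransfer ϱ (ExchangeUnstableLoc ε ϱ' Rm K) (ExchangeUnstableLoc ε ϱ' Rm K) :=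
  fun _ _ _ _ _ _ hsep _ hS h => exchangeUnstableLoc_of_motif hRm hϱ' hsep hS h

/-- ★ **The motif-decided local exchange test at sharp slack transfers to the cluster-level exemption**:
`ϱ′ + D ≤ Rm ≤ ϱ`, `1 ≤ D` ⟹ `MotifTransfer ϱ (ExchangeUnstableLoc (ε + 2K·T♯(D)) ϱ′ Rm K) (ExchangeUnstable ε ϱ′ K)`. [folklore] -/
theorem motifTransfer_exchangeUnstable_sharp {ε ϱ' Rm D ϱ : ℝ} {K : ℕ} (hRmD : ϱ' + D ≤ Rm) (hD : (1 : ℝ) ≤ D) (hRm : Rm ≤ ϱ) :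
    MotifTransfer ϱ (ExchangeUnstableLoc (ε + 2 * K * tailConstSharp D) ϱ' Rm K) (ExchangeUnstable ε ϱ' K) :=
  (motifTransfer_exchangeUnstableLoc hRm (by linarith)).of_imp (fun _ _ _ h => h) fun _ _ _ h => exchangeUnstable_of_loc_sharp hRmD hD h

/-- The same at the tree's crude slack `2K·T(D)` (`D ≥ 7/10`). [folklore] -/
theorem motifTransfer_exchangeUnstable {ε ϱ' Rm D ϱ : ℝ} {K : ℕ} (hRmD : ϱ' + D ≤ Rm) (hD : (7 : ℝ) / 10 ≤ D) (hRm : Rm ≤ ϱ) :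
    MotifTransfer ϱ (ExchangeUnstableLoc (ε + 2 * K * tailConst D) ϱ' Rm K) (ExchangeUnstable ε ϱ' K) :=
  (motifTransfer_exchangeUnstableLoc hRm (by linarith)).of_imp (fun _ _ _ h => h) fun _ _ _ h => exchangeUnstable_of_loc hRmD hD h

/-! ## §2. The one-atom move with dipole slack as a motif-decided site predicate -/

/-- **`MoveUnstableLoc ε Rm s`** — the one-atom move test of `…ExemptMoveDipole` as a site predicate: `y` is `7/10`-separated and some point `p` with
`dist p (y j) ≤ s`, `dist p (y j) < 7/10` lowers the LOCAL field (atoms `k ≠ j` within `Rm` of `y_j`) by more than `ε + s·(Rm/(Rm − s))⁷·S₇♯(Rm)`. -/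
def MoveUnstableLoc (ε Rm s : ℝ) : SitePred := fun _ y j =>
  Sep y ∧ ∃ p : EuclideanSpace ℝ (Fin 3), dist p (y j) ≤ s ∧ dist p (y j) < 7 / 10 ∧
    (∑ k ∈ (Finset.univ.erase j).filter (fun k => dist (y k) (y j) ≤ Rm), lennardJones (dist p (y k))) +
        (ε + s * (Rm / (Rm - s)) ^ 7 * (6000 / 343 * Rm⁻¹ ^ 4 + 2880 / 49 * Rm⁻¹ ^ 5 + 10 / 7 * Rm⁻¹ ^ 6 + 2 * Rm⁻¹ ^ 7)) <
      ∑ k ∈ (Finset.univ.erase j).filter (fun k => dist (y k) (y j) ≤ Rm), lennardJones (dist (y j) (y k))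

/-- A `7/10`-separated cluster is injective. [folklore] -/
theorem injective_of_sep {N : ℕ} {y : Fin N → E3} (hsep : Sep y) : Function.Injective y := by
  intro a b hab
  by_contra hne
  have h := hsep a b hne
  rw [hab, dist_self] at h
  linarith

/-- **The move test certifies the cluster-level exemption** (`1 + s ≤ Rm`): `MoveUnstableLoc ε Rm s ⟹ ExchangeUnstable ε s 1`. [folklore] -/
theorem exchangeUnstable_of_moveUnstableLoc {ε Rm s : ℝ} (hRm : 1 + s ≤ Rm) {N : ℕ} {y : Fin N → E3} {j : Fin N}
    (h : MoveUnstableLoc ε Rm s N y j) : ExchangeUnstable ε s 1 N y j := by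
  obtain ⟨hsep, p, hps, hp7, hgain⟩ := h
  exact exchangeUnstable_one_of_localMove_dipole hsep (injective_of_sep hsep) hps hp7 hps hRm hgain

/-- **The move test is deep-absent** (at depth `locOptDepth ε s 1`). [folklore] -/
theorem deepAbsent_moveUnstableLoc {ε Rm s : ℝ} (hε : 0 < ε) (hRm : 1 + s ≤ Rm) :
    DeepAbsent (locOptDepth ε s 1) (MoveUnstableLoc ε Rm s) :=
  (deepAbsent_exchangeUnstable hε).of_imp fun _ _ _ h => exchangeUnstable_of_moveUnstableLoc hRm h

/-- **Local sums agree between motif and cluster** (`Rm ≤ ϱ`, `φ` injective, the motif contains every cluster atom within `ϱ` of the centre). [folklore] -/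
theorem sum_local_motif {Rm ϱ : ℝ} (hRm : Rm ≤ ϱ) {N M : ℕ} {y : Fin N → E3} {φ : Fin M → Fin N} {c : Fin M}
    (hφ : Function.Injective φ) (hS : ∀ k : Fin N, dist (y k) (y (φ c)) ≤ ϱ → k ∈ Set.range φ) (g : E3 → ℝ) :
    ∑ a ∈ (Finset.univ.erase c).filter (fun a => dist ((y ∘ φ) a) ((y ∘ φ) c) ≤ Rm), g ((y ∘ φ) a) =
      ∑ k ∈ (Finset.univ.erase (φ c)).filter (fun k => dist (y k) (y (φ c)) ≤ Rm), g (y k) := by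
  have himg : (Finset.univ.erase (φ c)).filter (fun k => dist (y k) (y (φ c)) ≤ Rm) =
      ((Finset.univ.erase c).filter (fun a => dist ((y ∘ φ) a) ((y ∘ φ) c) ≤ Rm)).image φ := by
    ext k
    simp only [Finset.mem_filter, Finset.mem_erase, Finset.mem_univ, and_true, Finset.mem_image, Function.comp_apply]
    constructor
    · rintro ⟨hne, hk⟩
      obtain ⟨a, rfl⟩ := hS k (hk.trans hRm)
      exact ⟨a, ⟨fun h => hne (by rw [h]), hk⟩, rfl⟩
    · rintro ⟨a, ⟨hne, ha⟩, rfl⟩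
      exact ⟨fun h => hne (hφ h), ha⟩
  rw [himg, Finset.sum_image fun a _ b _ h => hφ h]
  rfl

/-- **`MoveUnstableLoc` on the motif ⟹ on the cluster** (`Rm ≤ ϱ`). [folklore] -/
theorem moveUnstableLoc_of_motif {ε Rm s ϱ : ℝ} (hRm : Rm ≤ ϱ) {N M : ℕ} {y : Fin N → E3} {φ : Fin M → Fin N} {c : Fin M}
    (hsep : Sep y) (hφ : Function.Injective φ) (hS : ∀ k : Fin N, dist (y k) (y (φ c)) ≤ ϱ → k ∈ Set.range φ)
    (h : MoveUnstableLoc ε Rm s M (y ∘ φ) c) : MoveUnstableLoc ε Rm s N y (φ c) := by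
  obtain ⟨-, p, hps, hp7, hgain⟩ := h
  have e1 := sum_local_motif hRm hφ hS (fun q => lennardJones (dist p q))
  have e2 := sum_local_motif hRm hφ hS (fun q => lennardJones (dist (y (φ c)) q))
  beta_reduce at e1 e2
  refine ⟨hsep, p, hps, hp7, ?_⟩
  rw [← e1, ← e2]
  exact hgain

/-- **`MotifTransfer` for the move test onto itself** (`Rm ≤ ϱ`). [folklore] -/
theorem motifTransfer_moveUnstableLoc {ε Rm s ϱ : ℝ} (hRm : Rm ≤ ϱ) :
    MotifTransfer ϱ (MoveUnstableLoc ε Rm s) (MoveUnstableLoc ε Rm s) :=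
  fun _ _ _ _ _ _ hsep hφ hS h => moveUnstableLoc_of_motif hRm hsep hφ hS h

/-- ★ **The motif-decided move test transfers to the cluster-level exemption**: `1 + s ≤ Rm ≤ ϱ` ⟹
`MotifTransfer ϱ (MoveUnstableLoc ε Rm s) (ExchangeUnstable ε s 1)`. [folklore] -/
theorem motifTransfer_exchangeUnstable_of_move {ε Rm s ϱ : ℝ} (hRm1 : 1 + s ≤ Rm) (hRm : Rm ≤ ϱ) :
    MotifTransfer ϱ (MoveUnstableLoc ε Rm s) (ExchangeUnstable ε s 1) :=
  (motifTransfer_moveUnstableLoc hRm).of_imp (fun _ _ _ h => h) fun _ _ _ h => exchangeUnstable_of_moveUnstableLoc hRm1 h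

/-! ## §3. The crux BY NAME from an X-motif certificate with a motif-decided exemption column -/

/-- ★★ **The crux with the ONE-ATOM-MOVE exemption column**: `MuEquilibriumDoor ∧ SF₄₅ ∧ UP(−0.7175) ∧ [rule F: range R′, locality ρ, bound B] ∧
X-motif certificate at `W₄₅ = effPot w₄₅ ω₄ (3/400)` (level `(e₁, −C, 0, −C)`, `C ≥ 0`, `e₁ > −0.7175`, capped scale `D`, radius
`ϱ ≥ max (9/2, R′ + ρ, ρ, R′, 13/10·D + 1, Rm)`, `1 + s ≤ Rm`, `ε > 0`, exemption column `MoveUnstableLoc ε Rm s`) `⟹ AperiodicFrustratedLawGap`. [folklore chaining] -/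
theorem aperiodicFrustratedLawGap_of_schurMotifX_move_fourHalf {η₁ e₁ C D ϱ R' ρ B ε Rm s : ℝ} {F : TransferRule}
    (hDoor : Summit.AtomisticToContinuum.Crystallization.Theses.GrainCoreNetworkSplit.MuEquilibriumDoor)
    (hF : SF₄₅) (hU : PeriodicEnergyCeiling (-(7175 / 10000))) (hε : 0 < ε) (hRm1 : 1 + s ≤ Rm) (hRm : Rm ≤ ϱ)
    (hF₁ : HasRange R' F) (hF₂ : IsLocal ρ F) (hF₃ : IsBounded B F)
    (hR : 9 / 2 ≤ ϱ) (hRρ : R' + ρ ≤ ϱ) (hρ : ρ ≤ ϱ) (hR' : R' ≤ ϱ) (hD : 13 / 10 * D + 1 ≤ ϱ) (hC : 0 ≤ C)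
    (he : -(7175 / 10000 : ℝ) < e₁)
    (h : PairRuleMotifCertificateX (1 / 20) η₁ (effPot w₄₅ ω₄ (3 / 400)) (3 / 400) e₁ (-C) 0 (-C) D ϱ F (MoveUnstableLoc ε Rm s)) :
    Summit.AtomisticToContinuum.Crystallization.Theses.FrustratedLawDichotomy.AperiodicFrustratedLawGap :=
  aperiodicFrustratedLawGap_of_schurMotifX_fourHalf hDoor hF hU (deepAbsent_exchangeUnstable (ϱ := s) (K := 1) hε)
    (motifTransfer_exchangeUnstable_of_move hRm1 hRm) hF₁ hF₂ hF₃ hR hRρ hρ hR' hD hC he h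

/-- ★★ **The crux with the LOCAL EXCHANGE exemption column at sharp slack**: as above with exemption column
`ExchangeUnstableLoc (ε + 2K·T♯(Dfar)) ϱ′ Rm K`, `ϱ′ + Dfar ≤ Rm ≤ ϱ`, `1 ≤ Dfar`, `ε > 0`. [folklore chaining] -/
theorem aperiodicFrustratedLawGap_of_schurMotifX_exchangeLoc_fourHalf {η₁ e₁ C D ϱ R' ρ B ε ϱ' Rm Dfar : ℝ} {K : ℕ} {F : TransferRule}
    (hDoor : Summit.AtomisticToContinuum.Crystallization.Theses.GrainCoreNetworkSplit.MuEquilibriumDoor)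
    (hF : SF₄₅) (hU : PeriodicEnergyCeiling (-(7175 / 10000))) (hε : 0 < ε) (hRmD : ϱ' + Dfar ≤ Rm) (hDfar : (1 : ℝ) ≤ Dfar)
    (hRm : Rm ≤ ϱ) (hF₁ : HasRange R' F) (hF₂ : IsLocal ρ F) (hF₃ : IsBounded B F)
    (hR : 9 / 2 ≤ ϱ) (hRρ : R' + ρ ≤ ϱ) (hρ : ρ ≤ ϱ) (hR' : R' ≤ ϱ) (hD : 13 / 10 * D + 1 ≤ ϱ) (hC : 0 ≤ C)
    (he : -(7175 / 10000 : ℝ) < e₁)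
    (h : PairRuleMotifCertificateX (1 / 20) η₁ (effPot w₄₅ ω₄ (3 / 400)) (3 / 400) e₁ (-C) 0 (-C) D ϱ F
      (ExchangeUnstableLoc (ε + 2 * K * tailConstSharp Dfar) ϱ' Rm K)) :
    Summit.AtomisticToContinuum.Crystallization.Theses.FrustratedLawDichotomy.AperiodicFrustratedLawGap :=
  aperiodicFrustratedLawGap_of_schurMotifX_fourHalf hDoor hF hU (deepAbsent_exchangeUnstable (ϱ := ϱ') (K := K) hε)
    (motifTransfer_exchangeUnstable_sharp hRmD hDfar hRm) hF₁ hF₂ hF₃ hR hRρ hρ hR' hD hC he h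

end Summit.AtomisticToContinuum.Crystallization.Theorems.FrustratedLawDichotomyPairPotentialDoorXMoves

end
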